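import Mathlib
import Literature.Computability.Complexity.ExtMonotoneGates
import Literature.Computability.Complexity.CliqueApproximatorsWide
import Literature.Computability.Complexity.RossmanMonotoneCliqueProb
import Literature.Computability.Complexity.RossmanMonotoneCliqueGraphs
import Summits.PneNP.PneNP.Theorems.ConvexRankGatesLinAlgGateBlindDefs
import Summits.PneNP.PneNP.Theorems.ConvexRankGatesLinAlgGateBlindPluckingBound

/-!
# The planting theorem `sg_of_maxtermCover` of line `dnf-invariant-wide-gates-see-small-cliques` for crux `LinAlgGateBlind` (stmt-PneNP-10681, route ConvexRankGates)

**SG for gates with few all-off events** (the reachable layer of the research stub `stub_sgPerm`; report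
of that stub, §1). Graphs `x : KEdge m → Bool` under the product measure `prob q` (`G(m,q)`), clique atoms
`⌈X⌉ = CliquePresent X`, and a Boolean function `O` on graphs with a MAXTERM COVER: families
`𝓛 j ⊆ 𝒱(l)`, `j < N`, such that `O x = 0` iff for some `j` every atom of `𝓛 j` is absent from `x`
(the all-off event `D_j`; for PERM term gates `j` ranges over subgroups, `isTermGate_perm_eq_false_iff`).
THEOREM (`sg_of_maxtermCover`): if `1 - q^{C(l,2)} ≤ 1/2`, `N·(1/2)^{ν+1} < η` and `2t ≤ l`, the MIXED
witness `𝒜 = {Y ∈ 𝒱(l) : Pr[O = 0 ∧ ⌈Y⌉] < η}` ("dead ends of planting") loses at most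
`(ν·C(l,2))^t · C(m-t, k-t)` bare `k`-cliques (`lostPos`) and gains at most `#𝒱(l)·η` of `G(m,q)`
(`gainedNeg`, a union bound). Steps of the positive side:
* PLANTING `x ⊔ cliqueVec Y` (switch the clique `K_Y` on): on `{O = 0 ∧ ⌈Y⌉}` planting changes nothing,
  so a LIVE `Y ∉ 𝒜` has a cover event surviving it, `Pr[D_j(x ⊔ K_Y)] ≥ η/N > (1/2)^{ν+1}`
  (`exists_fragile_of_live`; union bound `prob_exists_le`);
* FRAGILE EVENTS (`prob_planted_allOff_le`): members of `𝓛 j` with pairwise disjoint PRIVATE edge sets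
  `E(K_X) ∖ E(K_Y)` are absent from `x ⊔ K_Y` independently (`prob_forall_mem_exists_eq_false`, the
  `Finset`-indexed form of `prob_forall_exists_eq_false`), each with probability `≤ 1 - q^{C(l,2)} ≤ 1/2`;
* HITTING SETS (`exists_hittingSet_of_fragile`): so a maximal such subfamily has `≤ ν` members and the
  union `F_Y` of its private sets (`≤ ν·C(l,2)` edges, none inside `Y`) meets `E(K_X)` for all `X ∈ 𝓛 j`;
  an accepted bare clique `K_S` switches some `X ∈ 𝓛 j` on, so `S ⊇ endpts e` for some `e ∈ F_Y`
  (`exists_plantingHittingSet`);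
* PLANTING TREE (`card_lost_filter_supset_le`): branching over `e ∈ F_Y` from the root `∅` to depth `t`,
  one new vertex per level, bounds the lost cliques by `(ν·C(l,2))^t · C(m-t, k-t)` (superset count
  `card_filter_supset_le`, antitonicity `choose_sub_le_choose_sub`).

Sources: Alon–Boppana 1987 §3 (clique indicators; Lemma 3.6-type independence estimates), Razborov 1985,
finite product probability; the argument itself is new here (stub report `stub_sgPerm` §1). [folklore]
-/

-- `Summit.PneNP.PneNP.…` duplicates `PneNP` BY DESIGN (single-problem summit).
set_option linter.dupNamespace false

noncomputable section

namespace Summit.PneNP.PneNP.Cruxes.LinAlgGateBlind.DnfInvariantWideGatesSeeSmallCliques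

open scoped BigOperators
open Finset Literature.Computability.Complexity Razborov

variable {ι : Type*} [Fintype ι] [DecidableEq ι] {m : ℕ}

/-! ### Independence of missing coordinates in pairwise disjoint blocks (`Finset`-indexed form) -/

/-- **Missing coordinates in pairwise disjoint blocks are independent** (`Finset`-indexed form of
`prob_forall_exists_eq_false`): for blocks `P i`, `i ∈ s`, pairwise disjoint,
`Pr[∀ i ∈ s, some coordinate in P i is off] = ∏_{i ∈ s} (1 - p^{|P i|})`. [folklore] -/
theorem prob_forall_mem_exists_eq_false (p : ℝ) {β : Type*} [DecidableEq β] (s : Finset β)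
    (P : β → Finset ι) (hdisj : ∀ i ∈ s, ∀ j ∈ s, i ≠ j → Disjoint (P i) (P j)) :
    prob p (fun x : ι → Bool => ∀ i ∈ s, ∃ e ∈ P i, x e = false) = ∏ i ∈ s, (1 - p ^ #(P i)) := by
  induction s using Finset.induction_on with
  | empty =>
    rw [prod_empty, ← prob_true (ι := ι) p]
    exact prob_congr fun x => by simp
  | insert b s hb ih =>
    have hb' : ∀ i ∈ s, Disjoint (P i) (P b) := fun i hi =>
      hdisj i (mem_insert_of_mem hi) b (mem_insert_self b s) (fun h => hb (h ▸ hi))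
    rw [prod_insert hb, ← prob_exists_eq_false p (P b), ← ih fun i hi j hj hij =>
      hdisj i (mem_insert_of_mem hi) j (mem_insert_of_mem hj) hij,
      ← prob_and_eq_mul_of_dependsOn p (P b)]
    · exact prob_congr fun x => forall_mem_insert b s _
    · exact fun x y hxy => exists_congr fun e => and_congr_right fun he => by rw [hxy e he]
    · refine fun x y hxy => forall₂_congr fun i hi => exists_congr fun e => ?_
      exact and_congr_right fun he => by rw [hxy e (Finset.disjoint_left.1 (hb' i hi) he)]

/-! ### Planting a clique: the graph `x ⊔ K_Y`; fragile all-off events and hitting sets -/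

/-- Membership in `edgesIn`: both endpoints inside. [folklore] -/
theorem mem_edgesIn_iff_endpts (W : Finset (Fin m)) (e : KEdge m) : e ∈ edgesIn W ↔ endpts e ⊆ W := by
  simp only [edgesIn, mem_filter, mem_univ, true_and]

/-- The edges inside a `≤ l`-set outside any fixed edge set number at most `C(l, 2)`. [folklore] -/
theorem card_private_le {l : ℕ} {X : Finset (Fin m)} (hX : X ∈ smallSets (Fin m) l)
    (E : Finset (KEdge m)) : #(edgesIn X \ E) ≤ l.choose 2 :=
  calc #(edgesIn X \ E) ≤ #(edgesIn X) := card_le_card sdiff_subset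
    _ ≤ (#X).choose 2 := card_edgesIn_le _
    _ ≤ l.choose 2 := Nat.choose_le_choose 2 (mem_smallSets.1 hX).1

/-- An edge of the PLANTED graph `x ⊔ K_Y` is an edge of `x` or an edge inside `Y`. [folklore] -/
theorem planted_apply_eq_true_iff (x : KEdge m → Bool) (Y : Finset (Fin m)) (e : KEdge m) :
    (x ⊔ cliqueVec Y) e = true ↔ x e = true ∨ e ∈ edgesIn Y := by
  rw [mem_edgesIn_iff_endpts, ← cliqueVec_eq_true_iff_endpts]
  show (x e || cliqueVec Y e) = true ↔ _
  rw [Bool.or_eq_true]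

/-- Planting a clique that is already present changes nothing. [folklore] -/
theorem planted_eq_self_of_cliquePresent {x : KEdge m → Bool} {Y : Finset (Fin m)}
    (h : CliquePresent Y x) : x ⊔ cliqueVec Y = x :=
  sup_eq_left.2 fun e => by
    rcases hY : cliqueVec Y e with _ | _
    · exact Bool.false_le _
    · exact (h e ((cliqueVec_eq_true_iff Y e).1 hY)).symm.le

/-- An atom `⌈X⌉` absent from the planted graph `x ⊔ K_Y` misses a PRIVATE edge of `X` (one outside
`K_Y`), and that edge is off in `x`. [folklore] -/
theorem exists_private_eq_false {x : KEdge m → Bool} {Y X : Finset (Fin m)}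
    (h : ¬ CliquePresent X (x ⊔ cliqueVec Y)) : ∃ e ∈ edgesIn X \ edgesIn Y, x e = false := by
  by_contra hc
  push Not at hc
  refine h ((cliquePresent_iff_edgesIn _ _).2 fun e he => ?_)
  rw [planted_apply_eq_true_iff]
  by_cases heY : e ∈ edgesIn Y
  · exact Or.inr heY
  · exact Or.inl (Bool.ne_false_iff.1 (hc e (mem_sdiff.2 ⟨he, heY⟩)))

/-- **Fragile events.** If `𝒳 ⊆ 𝓛 ⊆ 𝒱(l)` has pairwise disjoint private edge sets `E(K_X) ∖ E(K_Y)`,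
the planted all-off event "every atom of `𝓛` is absent from `x ⊔ K_Y`" has probability at most
`(1 - q^{C(l,2)})^{#𝒳}`: each `X ∈ 𝒳` misses a private edge, off in `x`; these `#𝒳` events live on
pairwise disjoint coordinate blocks, each of probability `1 - q^{#private} ≤ 1 - q^{C(l,2)}`. [folklore] -/
theorem prob_planted_allOff_le {l : ℕ} {q : ℝ} (hq0 : 0 ≤ q) (hq1 : q ≤ 1) (Y : Finset (Fin m))
    {𝓛 𝒳 : Finset (Finset (Fin m))} (h𝒳 : 𝒳 ⊆ 𝓛) (h𝓛 : 𝓛 ⊆ smallSets (Fin m) l)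
    (hdisj : ∀ X ∈ 𝒳, ∀ X' ∈ 𝒳, X ≠ X' →
      Disjoint (edgesIn X \ edgesIn Y) (edgesIn X' \ edgesIn Y)) :
    prob q (fun x : KEdge m → Bool => ∀ X ∈ 𝓛, ¬ CliquePresent X (x ⊔ cliqueVec Y)) ≤
      (1 - q ^ (l.choose 2)) ^ #𝒳 := by
  classical
  calc prob q (fun x : KEdge m → Bool => ∀ X ∈ 𝓛, ¬ CliquePresent X (x ⊔ cliqueVec Y))
      ≤ prob q (fun x : KEdge m → Bool => ∀ X ∈ 𝒳, ∃ e ∈ edgesIn X \ edgesIn Y, x e = false) :=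
        prob_mono hq0 hq1 fun x hx X hX => exists_private_eq_false (hx X (h𝒳 hX))
    _ = ∏ X ∈ 𝒳, (1 - q ^ #(edgesIn X \ edgesIn Y)) :=
        prob_forall_mem_exists_eq_false q 𝒳 (fun X => edgesIn X \ edgesIn Y) hdisj
    _ ≤ ∏ _X ∈ 𝒳, (1 - q ^ (l.choose 2)) := by
        refine prod_le_prod (fun X _ => sub_nonneg.2 (pow_le_one₀ hq0 hq1)) fun X hX => ?_
        exact sub_le_sub_left (pow_le_pow_of_le_one hq0 hq1 (card_private_le (h𝓛 (h𝒳 hX)) _)) 1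
    _ = (1 - q ^ (l.choose 2)) ^ #𝒳 := prod_const _

/-- **Fragile event ⇒ small hitting set.** If `1 - q^{C(l,2)} ≤ 1/2` and the planted all-off event of
`𝓛 ⊆ 𝒱(l)` has probability `> (1/2)^{ν+1}`, there is an edge set `F`, `#F ≤ ν·C(l,2)`, avoiding
`E(K_Y)` and meeting `E(K_X)` for every `X ∈ 𝓛`: the union of the private sets of a MAXIMAL subfamily
with pairwise disjoint private sets (`≤ ν` members by `prob_planted_allOff_le`; private sets are nonempty
since the event is possible; maximality = hitting). [folklore] -/
theorem exists_hittingSet_of_fragile {l ν : ℕ} {q : ℝ} (hq0 : 0 ≤ q) (hq1 : q ≤ 1)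
    (hql : 1 - q ^ (l.choose 2) ≤ 1 / 2) (Y : Finset (Fin m)) {𝓛 : Finset (Finset (Fin m))}
    (h𝓛 : 𝓛 ⊆ smallSets (Fin m) l)
    (hfrag : (1 / 2 : ℝ) ^ (ν + 1) <
      prob q (fun x : KEdge m → Bool => ∀ X ∈ 𝓛, ¬ CliquePresent X (x ⊔ cliqueVec Y))) :
    ∃ F : Finset (KEdge m), #F ≤ ν * l.choose 2 ∧ (∀ e ∈ F, ¬ endpts e ⊆ Y) ∧
      ∀ X ∈ 𝓛, ∃ e ∈ F, e ∈ edgesIn X := by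
  classical
  -- private edge sets and admissible subfamilies (pairwise disjoint private sets)
  set P : Finset (Fin m) → Finset (KEdge m) := fun X => edgesIn X \ edgesIn Y with hP
  set adm : Finset (Finset (Finset (Fin m))) := 𝓛.powerset.filter fun 𝒳 =>
      ∀ X ∈ 𝒳, ∀ X' ∈ 𝒳, X ≠ X' → Disjoint (P X) (P X') with hadm
  have hmem_adm : ∀ 𝒳, 𝒳 ∈ adm ↔ 𝒳 ⊆ 𝓛 ∧ ∀ X ∈ 𝒳, ∀ X' ∈ 𝒳, X ≠ X' → Disjoint (P X) (P X') :=
    fun 𝒳 => by rw [hadm, mem_filter, mem_powerset]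
  obtain ⟨𝒳, h𝒳adm, hmax⟩ :=
    exists_max_image adm (fun 𝒳 => #𝒳) ⟨∅, (hmem_adm ∅).2 ⟨empty_subset _, by simp⟩⟩
  obtain ⟨h𝒳𝓛, hdisj⟩ := (hmem_adm 𝒳).1 h𝒳adm
  -- the maximal admissible subfamily has at most `ν` members
  have hsize : #𝒳 ≤ ν := by
    have h3 := hfrag.trans_le (prob_planted_allOff_le hq0 hq1 Y h𝒳𝓛 h𝓛 hdisj)
    have h4 : (1 - q ^ (l.choose 2)) ^ #𝒳 ≤ (1 / 2 : ℝ) ^ #𝒳 :=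
      pow_le_pow_left₀ (sub_nonneg.2 (pow_le_one₀ hq0 hq1)) hql _
    by_contra hlt
    have h5 : (1 / 2 : ℝ) ^ #𝒳 ≤ (1 / 2) ^ (ν + 1) :=
      pow_le_pow_of_le_one (by norm_num) (by norm_num) (by omega)
    linarith
  -- private sets are nonempty (else the planted all-off event is impossible)
  have hPne : ∀ X ∈ 𝓛, (P X).Nonempty := by
    intro X hX
    by_contra hPX
    have h0 : prob q (fun x : KEdge m → Bool => ∀ X ∈ 𝓛, ¬ CliquePresent X (x ⊔ cliqueVec Y)) ≤ 0 := by
      rw [← prob_false (ι := KEdge m) q]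
      refine prob_mono hq0 hq1 fun x hx => ?_
      obtain ⟨e, he, -⟩ := exists_private_eq_false (hx X hX)
      exact hPX ⟨e, he⟩
    exact absurd (hfrag.trans_le h0) (not_lt.2 (by positivity))
  refine ⟨𝒳.biUnion P, ?_, fun e he => ?_, fun X hX => ?_⟩
  · -- size
    calc #(𝒳.biUnion P) ≤ ∑ X ∈ 𝒳, #(P X) := card_biUnion_le
      _ ≤ ∑ _X ∈ 𝒳, l.choose 2 := sum_le_sum fun X hX => card_private_le (h𝓛 (h𝒳𝓛 hX)) _
      _ = #𝒳 * l.choose 2 := by rw [sum_const, smul_eq_mul]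
      _ ≤ ν * l.choose 2 := Nat.mul_le_mul_right _ hsize
  · -- all edges of `F` lie outside `K_Y`
    obtain ⟨X, -, heX⟩ := mem_biUnion.1 he
    rw [← mem_edgesIn_iff_endpts]
    exact (mem_sdiff.1 heX).2
  · -- hitting
    by_contra hmiss
    push Not at hmiss
    have hdj : ∀ X' ∈ 𝒳, Disjoint (P X) (P X') := fun X' hX' =>
      disjoint_left.2 fun e heX heX' => hmiss e (mem_biUnion.2 ⟨X', hX', heX'⟩) (mem_sdiff.1 heX).1
    by_cases hXmem : X ∈ 𝒳
    · obtain ⟨e, he⟩ := hPne X hX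
      exact hmiss e (mem_biUnion.2 ⟨X, hXmem, he⟩) (mem_sdiff.1 he).1
    · have hins : insert X 𝒳 ∈ adm := by
        refine (hmem_adm _).2 ⟨insert_subset hX h𝒳𝓛, fun A hA B hB hAB => ?_⟩
        rcases mem_insert.1 hA with rfl | hA'
        · rcases mem_insert.1 hB with rfl | hB'
          · exact absurd rfl hAB
          · exact hdj B hB'
        · rcases mem_insert.1 hB with rfl | hB'
          · exact (hdj A hA').symm
          · exact hdisj A hA' B hB' hAB
      have := hmax _ hins
      rw [card_insert_of_notMem hXmem] at this
      omega

/-- **Planting a live set.** If `Y` is LIVE for `O` at level `η` (`Pr[O = 0 ∧ ⌈Y⌉] ≥ η`) and the rejection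
region of `O` is covered by the `N` all-off events of `𝓛`, then some cover event survives planting `K_Y`
with probability `≥ η / N > (1/2)^{ν+1}` (on `{O = 0 ∧ ⌈Y⌉}` planting changes nothing; union bound over
`j`; `N·(1/2)^{ν+1} < η`). [folklore] -/
theorem exists_fragile_of_live {N ν : ℕ} {q η : ℝ} (hq0 : 0 ≤ q) (hq1 : q ≤ 1)
    (hN : (N : ℝ) * (1 / 2) ^ (ν + 1) < η) (O : (KEdge m → Bool) → Bool)
    (𝓛 : Fin N → Finset (Finset (Fin m))) (hcov : ∀ x, O x = false → ∃ j, ∀ X ∈ 𝓛 j, ¬ CliquePresent X x)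
    (Y : Finset (Fin m)) (hlive : η ≤ prob q (fun x : KEdge m → Bool => O x = false ∧ CliquePresent Y x)) :
    ∃ j, (1 / 2 : ℝ) ^ (ν + 1) <
      prob q (fun x : KEdge m → Bool => ∀ X ∈ 𝓛 j, ¬ CliquePresent X (x ⊔ cliqueVec Y)) := by
  have h1 : η ≤ ∑ j ∈ (univ : Finset (Fin N)),
      prob q (fun x : KEdge m → Bool => ∀ X ∈ 𝓛 j, ¬ CliquePresent X (x ⊔ cliqueVec Y)) :=
    calc η ≤ prob q (fun x : KEdge m → Bool => O x = false ∧ CliquePresent Y x) := hlive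
      _ ≤ prob q (fun x : KEdge m → Bool => ∃ j ∈ (univ : Finset (Fin N)),
            ∀ X ∈ 𝓛 j, ¬ CliquePresent X (x ⊔ cliqueVec Y)) := by
          refine prob_mono hq0 hq1 fun x hx => ?_
          obtain ⟨j, hj⟩ := hcov x hx.1
          exact ⟨j, mem_univ _, by rwa [planted_eq_self_of_cliquePresent hx.2]⟩
      _ ≤ ∑ j ∈ (univ : Finset (Fin N)),
            prob q (fun x : KEdge m → Bool => ∀ X ∈ 𝓛 j, ¬ CliquePresent X (x ⊔ cliqueVec Y)) :=
          prob_exists_le hq0 hq1 _ _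
  have hη : (0 : ℝ) < η := lt_of_le_of_lt (by positivity) hN
  have hNpos : 0 < N := Nat.pos_of_ne_zero fun h0 => by
    subst h0; rw [univ_eq_empty, sum_empty] at h1; linarith
  have hNR : (0 : ℝ) < N := Nat.cast_pos.2 hNpos
  have h2 : ∑ _j ∈ (univ : Finset (Fin N)), η / N ≤ ∑ j ∈ (univ : Finset (Fin N)),
      prob q (fun x : KEdge m → Bool => ∀ X ∈ 𝓛 j, ¬ CliquePresent X (x ⊔ cliqueVec Y)) := by
    rwa [sum_const, card_univ, Fintype.card_fin, nsmul_eq_mul, mul_div_cancel₀ η hNR.ne']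
  obtain ⟨j, -, hj⟩ := exists_le_of_sum_le (univ_nonempty_iff.2 ⟨⟨0, hNpos⟩⟩) h2
  refine ⟨j, lt_of_lt_of_le ?_ hj⟩
  rwa [lt_div_iff₀ hNR, mul_comm]

/-- **One step of the planting tree.** For a maxterm cover `𝓛` of `O` by `N` all-off events of families of
`≤ l`-sets, `1 - q^{C(l,2)} ≤ 1/2`, `N·(1/2)^{ν+1} < η` and a LIVE `Y` (`Pr[O = 0 ∧ ⌈Y⌉] ≥ η`): some edge set
`F`, `#F ≤ ν·C(l,2)`, no edge inside `Y`, meets every vertex set `S` whose bare clique `K_S` is accepted by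
`O` (an accepted `K_S` switches some `X ∈ 𝓛 j` on, i.e. `X ⊆ S` as `#X ≠ 1`). [folklore] -/
theorem exists_plantingHittingSet {l N ν : ℕ} {q η : ℝ} (hq0 : 0 ≤ q) (hq1 : q ≤ 1)
    (hql : 1 - q ^ (l.choose 2) ≤ 1 / 2) (hN : (N : ℝ) * (1 / 2) ^ (ν + 1) < η)
    (O : (KEdge m → Bool) → Bool) (𝓛 : Fin N → Finset (Finset (Fin m)))
    (h𝓛 : ∀ j, 𝓛 j ⊆ smallSets (Fin m) l) (hcov : ∀ x, O x = false → ∃ j, ∀ X ∈ 𝓛 j, ¬ CliquePresent X x)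
    (hsound : ∀ j x, (∀ X ∈ 𝓛 j, ¬ CliquePresent X x) → O x = false) (Y : Finset (Fin m))
    (hlive : η ≤ prob q (fun x : KEdge m → Bool => O x = false ∧ CliquePresent Y x)) :
    ∃ F : Finset (KEdge m), #F ≤ ν * l.choose 2 ∧ (∀ e ∈ F, ¬ endpts e ⊆ Y) ∧
      ∀ S : Finset (Fin m), O (cliqueVec S) = true → ∃ e ∈ F, endpts e ⊆ S := by
  obtain ⟨j, hj⟩ := exists_fragile_of_live hq0 hq1 hN O 𝓛 hcov Y hlive
  obtain ⟨F, hF, hFY, hhit⟩ := exists_hittingSet_of_fragile hq0 hq1 hql Y (h𝓛 j) hj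
  refine ⟨F, hF, hFY, fun S hS => ?_⟩
  have hex : ∃ X ∈ 𝓛 j, CliquePresent X (cliqueVec S) := by
    by_contra h
    push Not at h
    rw [hsound j _ h] at hS
    exact Bool.false_ne_true hS
  obtain ⟨X, hX, hXS⟩ := hex
  obtain ⟨e, he, heX⟩ := hhit X hX
  exact ⟨e, he, ((mem_edgesIn_iff_endpts X e).1 heX).trans
    ((cliquePresent_cliqueVec_iff (mem_smallSets.1 (h𝓛 j hX)).2).1 hXS)⟩

/-! ### The planting tree: counting lost bare cliques -/

/-- **The planting tree.** If every LIVE small set `Y ∈ 𝒱(l) ∖ 𝒜` has a hitting set of `≤ B` edges, none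
inside `Y`, meeting every vertex set whose bare clique `O` accepts, then for `Y ∈ 𝒱(l)`, `#Y + 2j ≤ l`,
`n ≤ min (#Y + j) k` (`k ≤ m`), at most `B^j · C(m - n, k - n)` LOST bare `k`-cliques (accepted by `O`, no
member of `𝒜` inside) contain `Y`. Induction on `j`: a lost `S ⊇ Y` makes `Y` live and `S ⊇ Y ∪ endpts e`
for a hitting edge `e` (`#Y + 1 ≤ #(Y ∪ endpts e) ≤ #Y + 2`); `j = 0` is the superset count
`card_filter_supset_le` with its antitonicity `choose_sub_le_choose_sub`. [folklore] -/
theorem card_lost_filter_supset_le {l k B : ℕ} (hkm : k ≤ m) (O : (KEdge m → Bool) → Bool)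
    (𝒜 : Finset (Finset (Fin m)))
    (hhit : ∀ Y ∈ smallSets (Fin m) l, Y ∉ 𝒜 → ∃ F : Finset (KEdge m), #F ≤ B ∧
      (∀ e ∈ F, ¬ endpts e ⊆ Y) ∧ ∀ S : Finset (Fin m), O (cliqueVec S) = true → ∃ e ∈ F, endpts e ⊆ S) :
    ∀ j : ℕ, ∀ Y ∈ smallSets (Fin m) l, #Y + 2 * j ≤ l → ∀ n, n ≤ #Y + j → n ≤ k →
      #((lostPos m k O 𝒜).filter fun S => Y ⊆ S) ≤ B ^ j * (m - n).choose (k - n) := by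
  intro j
  induction j with
  | zero =>
    intro Y _ _ n hn hnk
    rw [pow_zero, one_mul, Nat.mul_zero, Nat.add_zero] at *
    have hsub : (lostPos m k O 𝒜).filter (fun S => Y ⊆ S) ⊆
        (powersetCard k (univ : Finset (Fin m))).filter fun S => Y ⊆ S := by
      intro S hS
      simp only [lostPos, mem_filter] at hS ⊢
      exact ⟨hS.1.1, hS.2⟩
    by_cases hYk : #Y ≤ k
    · calc #((lostPos m k O 𝒜).filter fun S => Y ⊆ S)
          ≤ #((powersetCard k (univ : Finset (Fin m))).filter fun S => Y ⊆ S) := card_le_card hsub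
        _ ≤ (m - #Y).choose (k - #Y) := card_filter_supset_le (k := k) Y
        _ ≤ (m - n).choose (k - n) := choose_sub_le_choose_sub hn hYk hkm
    · have h0 : #((powersetCard k (univ : Finset (Fin m))).filter fun S => Y ⊆ S) = 0 :=
        card_eq_zero.2 (filter_false_of_mem fun S hS hYS =>
          hYk ((card_le_card hYS).trans_eq (mem_powersetCard.1 hS).2))
      have := card_le_card hsub
      omega
  | succ j ih =>
    intro Y hY hYl n hn hnk
    rcases ((lostPos m k O 𝒜).filter fun S => Y ⊆ S).eq_empty_or_nonempty with h0 | ⟨S₀, hS₀⟩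
    · rw [h0, card_empty]
      exact Nat.zero_le _
    -- `Y` is live
    have hY𝒜 : Y ∉ 𝒜 := by
      intro hYA
      rw [mem_filter] at hS₀
      obtain ⟨hS₀L, hYS₀⟩ := hS₀
      simp only [lostPos, mem_filter] at hS₀L
      exact hS₀L.2.2 ⟨Y, hYA, (cliquePresent_cliqueVec_self S₀).anti hYS₀⟩
    obtain ⟨F, hFB, hFY, hFhit⟩ := hhit Y hY hY𝒜
    -- branching over the hitting set
    have hcover : (lostPos m k O 𝒜).filter (fun S => Y ⊆ S) ⊆
        F.biUnion fun e => (lostPos m k O 𝒜).filter fun S => Y ∪ endpts e ⊆ S := by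
      intro S hS
      rw [mem_filter] at hS
      obtain ⟨hSL, hYS⟩ := hS
      have hOS : O (cliqueVec S) = true := by
        simp only [lostPos, mem_filter] at hSL
        exact hSL.2.1
      obtain ⟨e, he, heS⟩ := hFhit S hOS
      exact mem_biUnion.2 ⟨e, he, mem_filter.2 ⟨hSL, union_subset hYS heS⟩⟩
    have hbranch : ∀ e ∈ F,
        #((lostPos m k O 𝒜).filter fun S => Y ∪ endpts e ⊆ S) ≤ B ^ j * (m - n).choose (k - n) := by
      intro e he
      have hU : #(Y ∪ endpts e) ≤ #Y + 2 := (card_union_le _ _).trans (by rw [card_endpts])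
      have hL : #Y < #(Y ∪ endpts e) :=
        card_lt_card ⟨subset_union_left, fun h => hFY e he (union_subset_iff.1 h).2⟩
      have h2 : 2 ≤ #(Y ∪ endpts e) := (card_endpts e).symm.le.trans (card_le_card subset_union_right)
      refine ih (Y ∪ endpts e) ?_ ?_ n ?_ hnk
      · rw [mem_smallSets]
        omega
      · omega
      · omega
    calc #((lostPos m k O 𝒜).filter fun S => Y ⊆ S)
        ≤ #(F.biUnion fun e => (lostPos m k O 𝒜).filter fun S => Y ∪ endpts e ⊆ S) := card_le_card hcover
      _ ≤ ∑ e ∈ F, #((lostPos m k O 𝒜).filter fun S => Y ∪ endpts e ⊆ S) := card_biUnion_le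
      _ ≤ ∑ _e ∈ F, B ^ j * (m - n).choose (k - n) := sum_le_sum hbranch
      _ = #F * (B ^ j * (m - n).choose (k - n)) := by rw [sum_const, smul_eq_mul]
      _ ≤ B * (B ^ j * (m - n).choose (k - n)) := Nat.mul_le_mul_right _ hFB
      _ = B ^ (j + 1) * (m - n).choose (k - n) := by rw [pow_succ]; ring

/-! ### The planting theorem -/

/-- **The planting theorem (SG for gates with few all-off events; reachable layer of `stub_sgPerm`).** Let the
REJECTION region of `O` be covered by `N` events "all atoms of `𝓛 j` are off" (`𝓛 j ⊆ 𝒱(l)`), each inside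
the rejection region (a maxterm cover), `q ∈ [0,1]`, `1 - q^{C(l,2)} ≤ 1/2`, `0 < η`, `N·(1/2)^{ν+1} < η`,
`2t ≤ l`. Then the MIXED witness `𝒜 := {Y ∈ 𝒱(l) : Pr_{G(m,q)}[O = 0 ∧ ⌈Y⌉] < η}` ("dead ends of
planting") loses at most `(ν·C(l,2))^t · C(m - t, k - t)` bare `k`-cliques and gains at most `#𝒱(l) · η` of
`G(m,q)`. Negative side: union bound over `Y ∈ 𝒜`. Positive side: the planting tree
`card_lost_filter_supset_le` from the root `∅` to depth `t`, fed by `exists_plantingHittingSet` (live sets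
have hitting sets of `≤ ν·C(l,2)` edges). Report of stub `stub_sgPerm`, §1. [folklore] -/
theorem sg_of_maxtermCover : ∀ (m l k N ν t : ℕ) (q η : ℝ) (O : (KEdge m → Bool) → Bool) (𝓛 : Fin N → Finset (Finset (Fin m))), (∀ j, 𝓛 j ⊆ smallSets (Fin m) l) → (∀ x, O x = false → ∃ j, ∀ X ∈ 𝓛 j, ¬ CliquePresent X x) → (∀ j x, (∀ X ∈ 𝓛 j, ¬ CliquePresent X x) → O x = false) → 0 ≤ q → q ≤ 1 → 1 - q ^ (l.choose 2) ≤ 1 / 2 → 0 < η → (N : ℝ) * (1 / 2) ^ (ν + 1) < η → 2 * t ≤ l → ∃ 𝒜 ⊆ smallSets (Fin m) l, #(lostPos m k O 𝒜) ≤ (ν * l.choose 2) ^ t * (m - t).choose (k - t) ∧ gainedNeg m q O 𝒜 ≤ #(smallSets (Fin m) l) * η := by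
  intro m l k N ν t q η O 𝓛 h𝓛 hcov hsound hq0 hq1 hql hη hN htl
  set 𝒜 : Finset (Finset (Fin m)) := (smallSets (Fin m) l).filter fun Y =>
    prob q (fun x : KEdge m → Bool => O x = false ∧ CliquePresent Y x) < η with h𝒜
  have h𝒜sub : 𝒜 ⊆ smallSets (Fin m) l := filter_subset _ _
  refine ⟨𝒜, h𝒜sub, ?_, ?_⟩
  · -- positive side: the planting tree from the root `∅`
    by_cases hkm : k ≤ m
    · have hhit : ∀ Y ∈ smallSets (Fin m) l, Y ∉ 𝒜 → ∃ F : Finset (KEdge m), #F ≤ ν * l.choose 2 ∧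
          (∀ e ∈ F, ¬ endpts e ⊆ Y) ∧ ∀ S : Finset (Fin m), O (cliqueVec S) = true → ∃ e ∈ F, endpts e ⊆ S :=
        fun Y hY hY𝒜 => exists_plantingHittingSet hq0 hq1 hql hN O 𝓛 h𝓛 hcov hsound Y
          (le_of_not_gt fun hlt => hY𝒜 (mem_filter.2 ⟨hY, hlt⟩))
      have htree := card_lost_filter_supset_le hkm O 𝒜 hhit t ∅ (empty_mem_smallSets l)
        (by rw [card_empty, Nat.zero_add]; exact htl) (min t k)
        (by rw [card_empty, Nat.zero_add]; exact min_le_left t k) (min_le_right t k)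
      have hfilt : (lostPos m k O 𝒜).filter (fun S => (∅ : Finset (Fin m)) ⊆ S) = lostPos m k O 𝒜 :=
        filter_true_of_mem fun S _ => empty_subset S
      have hchoose : (m - min t k).choose (k - min t k) = (m - t).choose (k - t) := by
        rcases le_total t k with h | h
        · rw [min_eq_left h]
        · rw [min_eq_right h, Nat.sub_self, Nat.choose_zero_right, Nat.sub_eq_zero_of_le h,
            Nat.choose_zero_right]
      rwa [hfilt, hchoose] at htree
    · -- no `k`-sets at all
      have h0 : lostPos m k O 𝒜 = ∅ := by
        rw [lostPos, powersetCard_eq_empty.2 (by rw [card_univ, Fintype.card_fin]; omega)]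
        rfl
      rw [h0, card_empty]
      exact Nat.zero_le _
  · -- negative side: union bound over the dead ends
    unfold gainedNeg
    calc prob q (fun x : KEdge m → Bool => O x = false ∧ Accepts 𝒜 x)
        = prob q (fun x : KEdge m → Bool => ∃ Y ∈ 𝒜, O x = false ∧ CliquePresent Y x) :=
          prob_congr fun x =>
            ⟨fun ⟨hOx, Y, hY, hYx⟩ => ⟨Y, hY, hOx, hYx⟩, fun ⟨Y, hY, hOx, hYx⟩ => ⟨hOx, Y, hY, hYx⟩⟩
      _ ≤ ∑ Y ∈ 𝒜, prob q (fun x : KEdge m → Bool => O x = false ∧ CliquePresent Y x) :=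
          prob_exists_le hq0 hq1 𝒜 _
      _ ≤ ∑ _Y ∈ 𝒜, η := sum_le_sum fun Y hY => (mem_filter.1 hY).2.le
      _ = #𝒜 * η := by rw [sum_const, nsmul_eq_mul]
      _ ≤ #(smallSets (Fin m) l) * η :=
          mul_le_mul_of_nonneg_right (Nat.cast_le.2 (card_le_card h𝒜sub)) hη.le

end Summit.PneNP.PneNP.Cruxes.LinAlgGateBlind.DnfInvariantWideGatesSeeSmallCliques

end
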